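import Literature.NumberTheory.Sieve.LinearEquationsInPrimesNilObstruction
import Mathlib.Geometry.Manifold.Algebra.LieGroup
import Mathlib.Analysis.Convex.Contractible
import Mathlib.AlgebraicTopology.FundamentalGroupoid.SimplyConnected
import Mathlib.Topology.Metrizable.Urysohn
import Mathlib.Topology.Algebra.Group.Basic
import Mathlib.Topology.Algebra.IsUniformGroup.Basic
import Mathlib.Topology.Algebra.ConstMulAction
import HarnessLib

/-!
# Linear equations in primes: the Heisenberg nilmanifold (Green–Tao 2010, §8, Cor. 11.6, App. E)

Trunk T-SIEVE (`Literature/NumberTheory/Sieve`), fourth file of the App. E / §11 programme in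
the inline decomposition of `Literature.NumberTheory.Sieve.GreenTao2010_gowersUniformity`
(B. Green, T. Tao, *Linear equations in primes*, Ann. of Math. 171 (2010), Thm. 7.2). The
previous files prove Cor. 11.6 ("nilsequences obstruct uniformity") for every nilmanifold whose
lower central series is rational with respect to `Γ` (Lemma E.9, a theorem of Mal'cev that the
abstract structure `Nilmanifold s` cannot yet prove in general). This file constructs the first
genuinely `2`-step example of the series and verifies Lemma E.9 for it by hand, as the paper
suggests ("To obtain results such as the Main Theorem in the case `s = 2`, we need only consider
nilmanifolds which are products of Heisenberg examples … In this case, Lemma E.9 can easily be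
verified by hand", Remark after Lemma E.9):

* `Heis` — the Heisenberg group `H³(ℝ)`, `ℝ³` with `(x,y,z)·(x',y',z') = (x+x', y+y', z+z'+xy')`
  (a type synonym of `ℝ × ℝ × ℝ`; topology, metric, charts and smooth structure are those of `ℝ³`,
  the group law is polynomial, hence a Lie group: `Heis.instLieGroup`); it is connected, simply
  connected and `2`-step nilpotent (`Heis.lowerCentralSeries_two`, via
  `[G, G] = {(0,0,z)}`, `Heis.commutator_eq_centerZ`);
* `Heis.latticeΓ` — the integer points `H³(ℤ)`, a discrete subgroup (`instDiscreteTopology`)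
  with compact quotient (`instCompactSpaceQuotient`, fundamental domain `[0,1]³`,
  `exists_mul_mem_cube`); the quotient is Hausdorff (properly discontinuous action), second
  countable, hence metrisable, and `Heis.quotientMetric` is a metric inducing its topology;
* `Nilmanifold.heisenberg : Nilmanifold 2` — the Heisenberg nilmanifold `H³(ℝ)/H³(ℤ)` as an
  instance of Def. 8.1;
* `Nilmanifold.heisenberg_isRational` — Lemma E.9 for it, by hand;
* `GreenTao2010_nilObstructionAt_two_heisenberg` — **Cor. 11.6 for the Heisenberg nilmanifold,
  unconditionally** (and Prop. 11.5 likewise).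

Not here: products of Heisenberg nilmanifolds (the family relevant to `GI(2)`), the skew-shift
computations of §11, Example 2; `GI(2)` itself (Green–Tao 2008).

## References

* B. Green, T. Tao, *Linear equations in primes*, Ann. of Math. (2) 171 (2010), 1753–1850
  (arXiv:math/0606088): Def. 8.1, §11 (Example after Prop. 11.5), Cor. 11.6, App. E (Remark
  after Lemma E.9).
-/

noncomputable section

open scoped Manifold ContDiff commutatorElement

namespace Literature.NumberTheory.Sieve

/-- The Heisenberg group `G = H³(ℝ)`: `ℝ³` with the multiplication
`(x, y, z) · (x', y', z') = (x + x', y + y', z + z' + x y')` (the upper triangular unipotent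
matrices `[[1, x, z], [0, 1, y], [0, 0, 1]]`). A type synonym of `ℝ × ℝ × ℝ` carrying this group
law. [cite: GreenTao2010, §8, Example (Heisenberg nilflow) and App. E, Remark after Lemma E.9] -/
def Heis : Type := ℝ × ℝ × ℝ

namespace Heis

/-- The coordinates of an element of the Heisenberg group. [folklore] -/
def toProd (g : Heis) : ℝ × ℝ × ℝ := g

/-- The element of the Heisenberg group with given coordinates. [folklore] -/
def mk (x y z : ℝ) : Heis := show ℝ × ℝ × ℝ from (x, y, z)

/-- First coordinate. [folklore] -/
def x (g : Heis) : ℝ := g.toProd.1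
/-- Second coordinate. [folklore] -/
def y (g : Heis) : ℝ := g.toProd.2.1
/-- Third coordinate. [folklore] -/
def z (g : Heis) : ℝ := g.toProd.2.2

/-- Coordinates of `mk`. [folklore] -/
@[simp] theorem x_mk (a b c : ℝ) : (mk a b c).x = a := rfl
/-- Coordinates of `mk`. [folklore] -/
@[simp] theorem y_mk (a b c : ℝ) : (mk a b c).y = b := rfl
/-- Coordinates of `mk`. [folklore] -/
@[simp] theorem z_mk (a b c : ℝ) : (mk a b c).z = c := rfl

/-- Extensionality in coordinates. [folklore] -/
@[ext] theorem ext {g h : Heis} (hx : g.x = h.x) (hy : g.y = h.y) (hz : g.z = h.z) : g = h :=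
  Prod.ext hx (Prod.ext hy hz)

/-- An element is `mk` of its coordinates. [folklore] -/
theorem mk_xyz (g : Heis) : mk g.x g.y g.z = g := rfl

/-- The Heisenberg multiplication `(x, y, z) · (x', y', z') = (x + x', y + y', z + z' + x y')`.
[cite: GreenTao2010, §8] -/
instance instMul : Mul Heis := ⟨fun g h => mk (g.x + h.x) (g.y + h.y) (g.z + h.z + g.x * h.y)⟩
/-- The identity `(0, 0, 0)`. [folklore] -/
instance instOne : One Heis := ⟨mk 0 0 0⟩
/-- The inverse `(x, y, z)⁻¹ = (-x, -y, -z + x y)`. [folklore] -/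
instance instInv : Inv Heis := ⟨fun g => mk (-g.x) (-g.y) (-g.z + g.x * g.y)⟩

/-- First coordinate of a product. [cite: GreenTao2010, §8] -/
@[simp] theorem x_mul (g h : Heis) : (g * h).x = g.x + h.x := rfl
/-- Second coordinate of a product. [cite: GreenTao2010, §8] -/
@[simp] theorem y_mul (g h : Heis) : (g * h).y = g.y + h.y := rfl
/-- Third coordinate of a product. [cite: GreenTao2010, §8] -/
@[simp] theorem z_mul (g h : Heis) : (g * h).z = g.z + h.z + g.x * h.y := rfl
/-- Coordinates of the identity. [folklore] -/
@[simp] theorem x_one : (1 : Heis).x = 0 := rfl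
/-- Coordinates of the identity. [folklore] -/
@[simp] theorem y_one : (1 : Heis).y = 0 := rfl
/-- Coordinates of the identity. [folklore] -/
@[simp] theorem z_one : (1 : Heis).z = 0 := rfl
/-- Coordinates of the inverse. [folklore] -/
@[simp] theorem x_inv (g : Heis) : g⁻¹.x = -g.x := rfl
/-- Coordinates of the inverse. [folklore] -/
@[simp] theorem y_inv (g : Heis) : g⁻¹.y = -g.y := rfl
/-- Coordinates of the inverse. [folklore] -/
@[simp] theorem z_inv (g : Heis) : g⁻¹.z = -g.z + g.x * g.y := rfl

/-- The Heisenberg group law. [cite: GreenTao2010, §8] -/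
instance instGroup : Group Heis where
  mul_assoc a b c := by
    apply ext
    · simp [add_assoc]
    · simp [add_assoc]
    · simp only [x_mul, y_mul, z_mul]; ring
  one_mul a := by apply ext <;> simp
  mul_one a := by apply ext <;> simp
  inv_mul_cancel a := by
    apply ext
    · simp
    · simp
    · simp only [z_mul, x_inv, z_inv, z_one]; ring

/-- The commutator in the Heisenberg group: `⁅g, h⁆ = (0, 0, g.x h.y - h.x g.y)`. [folklore] -/
theorem commutatorElement_eq (g h : Heis) :
    (⁅g, h⁆ : Heis) = mk 0 0 (g.x * h.y - h.x * g.y) := by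
  rw [commutatorElement_def]
  apply ext
  · simp
  · simp
  · simp only [x_mul, z_mul, x_inv, y_inv, z_inv, z_mk]; ring

/-! ### Topology and smooth structure (those of `ℝ³`) -/

/-- `H³(ℝ)` carries the metric of `ℝ³` (sup metric). [folklore] -/
instance instMetricSpace : MetricSpace Heis := inferInstanceAs (MetricSpace (ℝ × ℝ × ℝ))
/-- `H³(ℝ)` is a proper metric space (as `ℝ³`), hence locally compact. [folklore] -/
instance instProperSpace : ProperSpace Heis := inferInstanceAs (ProperSpace (ℝ × ℝ × ℝ))
/-- `H³(ℝ)` is second countable (as `ℝ³`). [folklore] -/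
instance instSecondCountable : SecondCountableTopology Heis :=
  inferInstanceAs (SecondCountableTopology (ℝ × ℝ × ℝ))
/-- `H³(ℝ)` is charted on `ℝ³` by the identity. [folklore] -/
instance instChartedSpace : ChartedSpace (ℝ × ℝ × ℝ) Heis :=
  inferInstanceAs (ChartedSpace (ℝ × ℝ × ℝ) (ℝ × ℝ × ℝ))
/-- `H³(ℝ)` is a smooth manifold (as `ℝ³`). [folklore] -/
instance instIsManifold : IsManifold 𝓘(ℝ, ℝ × ℝ × ℝ) ∞ Heis :=
  inferInstanceAs (IsManifold 𝓘(ℝ, ℝ × ℝ × ℝ) ∞ (ℝ × ℝ × ℝ))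
/-- `H³(ℝ)` is connected (as `ℝ³`). [cite: GreenTao2010, Def. 8.1] -/
instance instConnectedSpace : ConnectedSpace Heis := inferInstanceAs (ConnectedSpace (ℝ × ℝ × ℝ))
/-- `H³(ℝ)` is simply connected (as `ℝ³`, contractible). [cite: GreenTao2010, Def. 8.1] -/
instance instSimplyConnectedSpace : SimplyConnectedSpace Heis :=
  inferInstanceAs (SimplyConnectedSpace (ℝ × ℝ × ℝ))

/-- The first coordinate is continuous. [folklore] -/
theorem continuous_x : Continuous x := continuous_fst (X := ℝ) (Y := ℝ × ℝ)
/-- The second coordinate is continuous. [folklore] -/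
theorem continuous_y : Continuous y := (continuous_fst (X := ℝ) (Y := ℝ)).comp (continuous_snd (X := ℝ) (Y := ℝ × ℝ))
/-- The third coordinate is continuous. [folklore] -/
theorem continuous_z : Continuous z := (continuous_snd (X := ℝ) (Y := ℝ)).comp (continuous_snd (X := ℝ) (Y := ℝ × ℝ))
/-- `mk` of continuous coordinates is continuous. [folklore] -/
theorem continuous_mk {α : Type*} [TopologicalSpace α] {f g h : α → ℝ} (hf : Continuous f)
    (hg : Continuous g) (hh : Continuous h) : Continuous fun a => mk (f a) (g a) (h a) :=
  hf.prodMk (hg.prodMk hh)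

/-- The Heisenberg group is a Lie group (the group law is polynomial). [cite: GreenTao2010, §8] -/
instance instLieGroup : LieGroup 𝓘(ℝ, ℝ × ℝ × ℝ) ∞ Heis where
  contMDiff_mul := by
    change ContMDiff (𝓘(ℝ, ℝ × ℝ × ℝ).prod 𝓘(ℝ, ℝ × ℝ × ℝ)) 𝓘(ℝ, ℝ × ℝ × ℝ) ∞
      (fun p : (ℝ × ℝ × ℝ) × (ℝ × ℝ × ℝ) =>
        ((p.1.1 + p.2.1, p.1.2.1 + p.2.2.1, p.1.2.2 + p.2.2.2 + p.1.1 * p.2.2.1) : ℝ × ℝ × ℝ))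
    rw [← modelWithCornersSelf_prod, chartedSpaceSelf_prod]
    apply ContDiff.contMDiff
    fun_prop
  contMDiff_inv := by
    change ContMDiff 𝓘(ℝ, ℝ × ℝ × ℝ) 𝓘(ℝ, ℝ × ℝ × ℝ) ∞
      (fun p : ℝ × ℝ × ℝ => ((-p.1, -p.2.1, -p.2.2 + p.1 * p.2.1) : ℝ × ℝ × ℝ))
    apply ContDiff.contMDiff
    fun_prop

/-- `H³(ℝ)` is a topological group (a Lie group). [folklore] -/
instance instIsTopologicalGroup : IsTopologicalGroup Heis :=
  topologicalGroup_of_lieGroup 𝓘(ℝ, ℝ × ℝ × ℝ) ∞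

/-! ### Nilpotency: `G_2 = [G, G] = Z(G) = {(0, 0, z)}` and `G_3 = {1}` -/

/-- The centre `{(0, 0, z)}`. [folklore] -/
def centerZ : Subgroup Heis where
  carrier := {g | g.x = 0 ∧ g.y = 0}
  mul_mem' := by
    rintro g h ⟨hgx, hgy⟩ ⟨hhx, hhy⟩
    exact ⟨by simp [hgx, hhx], by simp [hgy, hhy]⟩
  one_mem' := ⟨rfl, rfl⟩
  inv_mem' := by
    rintro g ⟨hgx, hgy⟩
    exact ⟨by simp [hgx], by simp [hgy]⟩

/-- Membership in the centre. [folklore] -/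
theorem mem_centerZ {g : Heis} : g ∈ centerZ ↔ g.x = 0 ∧ g.y = 0 := Iff.rfl

/-- `[G, G] = {(0, 0, z)}`. [folklore] -/
theorem commutator_eq_centerZ : ⁅(⊤ : Subgroup Heis), (⊤ : Subgroup Heis)⁆ = centerZ := by
  apply le_antisymm
  · rw [Subgroup.commutator_le]
    intro g _ h _
    rw [commutatorElement_eq]
    exact ⟨rfl, rfl⟩
  · intro g hg
    obtain ⟨hx, hy⟩ := mem_centerZ.mp hg
    have : g = ⁅mk g.z 0 0, mk 0 1 0⁆ := by
      rw [commutatorElement_eq]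
      apply ext <;> simp [hx, hy]
    rw [this]
    exact Subgroup.commutator_mem_commutator (Subgroup.mem_top _) (Subgroup.mem_top _)

/-- The Heisenberg group is `2`-step nilpotent: `G_3 = [G, [G, G]] = {1}`. [cite: GreenTao2010, §8] -/
theorem lowerCentralSeries_two : (⊤ : Subgroup Heis).lowerCentralSeries 2 = ⊥ := by
  rw [Subgroup.lowerCentralSeries_succ, Subgroup.lowerCentralSeries_succ,
    Subgroup.lowerCentralSeries_zero, commutator_eq_centerZ, eq_bot_iff, Subgroup.commutator_le]
  intro g hg h _
  obtain ⟨hx, hy⟩ := mem_centerZ.mp hg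
  rw [commutatorElement_eq, Subgroup.mem_bot]
  apply ext <;> simp [hx, hy]

/-! ### The lattice `Γ = H³(ℤ)` -/

/-- The integer points `Γ = {(a, b, c) : a, b, c ∈ ℤ}`, a subgroup. [cite: GreenTao2010, §8] -/
def latticeΓ : Subgroup Heis where
  carrier := {g | (∃ a : ℤ, g.x = a) ∧ (∃ b : ℤ, g.y = b) ∧ ∃ c : ℤ, g.z = c}
  mul_mem' := by
    rintro g h ⟨⟨a, ha⟩, ⟨b, hb⟩, ⟨c, hc⟩⟩ ⟨⟨a', ha'⟩, ⟨b', hb'⟩, ⟨c', hc'⟩⟩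
    exact ⟨⟨a + a', by simp [ha, ha']⟩, ⟨b + b', by simp [hb, hb']⟩,
      ⟨c + c' + a * b', by simp [hc, hc', ha, hb']⟩⟩
  one_mem' := ⟨⟨0, by simp⟩, ⟨0, by simp⟩, ⟨0, by simp⟩⟩
  inv_mem' := by
    rintro g ⟨⟨a, ha⟩, ⟨b, hb⟩, ⟨c, hc⟩⟩
    exact ⟨⟨-a, by simp [ha]⟩, ⟨-b, by simp [hb]⟩, ⟨-c + a * b, by simp [hc, ha, hb]⟩⟩

/-- Membership in `Γ`: integer coordinates. [cite: GreenTao2010, §8] -/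
theorem mem_latticeΓ {g : Heis} :
    g ∈ latticeΓ ↔ (∃ a : ℤ, g.x = a) ∧ (∃ b : ℤ, g.y = b) ∧ ∃ c : ℤ, g.z = c := Iff.rfl

/-- Integer points lie in `Γ`. [folklore] -/
theorem mk_int_mem (a b c : ℤ) : mk a b c ∈ latticeΓ := ⟨⟨a, rfl⟩, ⟨b, rfl⟩, ⟨c, rfl⟩⟩

/-- The distance on `Heis = ℝ³` dominates each coordinate difference. [folklore] -/
theorem abs_sub_le_dist (g h : Heis) :
    |g.x - h.x| ≤ dist g h ∧ |g.y - h.y| ≤ dist g h ∧ |g.z - h.z| ≤ dist g h := by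
  have e : dist g h = dist g.toProd h.toProd := rfl
  rw [e, Prod.dist_eq, Prod.dist_eq]
  refine ⟨?_, ?_, ?_⟩
  · rw [← Real.dist_eq]; exact le_max_left _ _
  · rw [← Real.dist_eq]; exact (le_max_left _ _).trans (le_max_right _ _)
  · rw [← Real.dist_eq]; exact (le_max_right _ _).trans (le_max_right _ _)

/-- `Γ` is discrete (two lattice points at distance `< 1` coincide). [cite: GreenTao2010, §8] -/
instance instDiscreteTopology : DiscreteTopology latticeΓ := by
  rw [discreteTopology_iff_isOpen_singleton_one, isOpen_induced_iff]
  refine ⟨Metric.ball 1 1, Metric.isOpen_ball, ?_⟩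
  ext ⟨γ', hγ'⟩
  simp only [Set.mem_preimage, Metric.mem_ball, Set.mem_singleton_iff]
  constructor
  · intro hd
    obtain ⟨⟨a', ha'⟩, ⟨b', hb'⟩, ⟨c', hc'⟩⟩ := hγ'
    obtain ⟨h1, h2, h3⟩ := abs_sub_le_dist γ' 1
    simp only [x_one, y_one, z_one, sub_zero] at h1 h2 h3
    have j1 : a' = 0 := by
      have : |((a' : ℤ) : ℝ)| < 1 := by rw [← ha']; linarith
      rw [← Int.cast_abs, ← Int.cast_one, Int.cast_lt, Int.abs_lt_one_iff] at this; exact this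
    have j2 : b' = 0 := by
      have : |((b' : ℤ) : ℝ)| < 1 := by rw [← hb']; linarith
      rw [← Int.cast_abs, ← Int.cast_one, Int.cast_lt, Int.abs_lt_one_iff] at this; exact this
    have j3 : c' = 0 := by
      have : |((c' : ℤ) : ℝ)| < 1 := by rw [← hc']; linarith
      rw [← Int.cast_abs, ← Int.cast_one, Int.cast_lt, Int.abs_lt_one_iff] at this; exact this
    apply Subtype.ext
    apply ext
    · simp [ha', j1]
    · simp [hb', j2]
    · simp [hc', j3]
  · intro h
    have h1 : γ' = 1 := by simpa using congrArg Subtype.val h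
    rw [h1, dist_self]
    norm_num

/-! ### Compactness of `G/Γ`: the fundamental domain `[0,1]³` -/

/-- Every coset `gΓ` meets the unit cube: `g γ ∈ [0,1)³` for a suitable `γ ∈ Γ`. [cite: GreenTao2010, §8] -/
theorem exists_mul_mem_cube (g : Heis) :
    ∃ γ ∈ latticeΓ, (g * γ).x ∈ Set.Icc (0 : ℝ) 1 ∧ (g * γ).y ∈ Set.Icc (0 : ℝ) 1 ∧
      (g * γ).z ∈ Set.Icc (0 : ℝ) 1 := by
  set a : ℤ := -⌊g.x⌋
  set b : ℤ := -⌊g.y⌋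
  set c : ℤ := -⌊g.z + g.x * b⌋
  refine ⟨mk a b c, mk_int_mem a b c, ?_, ?_, ?_⟩
  · simp only [x_mul, x_mk, Set.mem_Icc]
    have h1 := Int.floor_le g.x
    have h2 := Int.lt_floor_add_one g.x
    constructor <;> push_cast [a] <;> linarith
  · simp only [y_mul, y_mk, Set.mem_Icc]
    have h1 := Int.floor_le g.y
    have h2 := Int.lt_floor_add_one g.y
    constructor <;> push_cast [b] <;> linarith
  · simp only [z_mul, z_mk, y_mk, Set.mem_Icc]
    have h1 := Int.floor_le (g.z + g.x * b)
    have h2 := Int.lt_floor_add_one (g.z + g.x * b)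
    constructor <;> push_cast [c] <;> linarith

/-- `G/Γ` is compact (the image of the compact cube `[0,1]³`). [cite: GreenTao2010, §8] -/
instance instCompactSpaceQuotient : CompactSpace (Heis ⧸ latticeΓ) := by
  refine ⟨?_⟩
  have hK : IsCompact ((fun p : ℝ × ℝ × ℝ => mk p.1 p.2.1 p.2.2) ''
      (Set.Icc (0 : ℝ) 1 ×ˢ (Set.Icc (0 : ℝ) 1 ×ˢ Set.Icc (0 : ℝ) 1))) :=
    ((isCompact_Icc.prod (isCompact_Icc.prod isCompact_Icc)).image
      (continuous_mk continuous_fst (continuous_fst.comp continuous_snd)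
        (continuous_snd.comp continuous_snd)))
  have hsurj : (QuotientGroup.mk : Heis → Heis ⧸ latticeΓ) ''
      ((fun p : ℝ × ℝ × ℝ => mk p.1 p.2.1 p.2.2) ''
        (Set.Icc (0 : ℝ) 1 ×ˢ (Set.Icc (0 : ℝ) 1 ×ˢ Set.Icc (0 : ℝ) 1))) = Set.univ := by
    apply Set.eq_univ_of_forall
    intro q
    obtain ⟨g, rfl⟩ := QuotientGroup.mk_surjective q
    obtain ⟨γ, hγ, hx, hy, hz⟩ := exists_mul_mem_cube g
    refine ⟨g * γ, ⟨((g * γ).x, (g * γ).y, (g * γ).z), ⟨hx, hy, hz⟩, mk_xyz _⟩, ?_⟩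
    rw [QuotientGroup.mk_mul_of_mem g hγ]
  rw [← hsurj]
  exact hK.image QuotientGroup.continuous_mk

/-! ### The quotient is Hausdorff and metrisable -/

/-- `Γ` acts properly discontinuously on `H³(ℝ)` by right multiplication (discrete and closed).
[folklore] -/
instance instProperlyDiscontinuous : ProperlyDiscontinuousSMul latticeΓ.op Heis :=
  latticeΓ.properlyDiscontinuousSMul_opposite_of_tendsto_cofinite
    (Subgroup.tendsto_coe_cofinite_of_discrete latticeΓ
      (isDiscrete_iff_discreteTopology.mpr (inferInstanceAs (DiscreteTopology latticeΓ))))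

/-- `G/Γ` is Hausdorff (quotient of a locally compact Hausdorff space by a properly discontinuous
action). [folklore] -/
instance instT2SpaceQuotient : T2Space (Heis ⧸ latticeΓ) :=
  inferInstanceAs (T2Space (Quotient (MulAction.orbitRel latticeΓ.op Heis)))

/-- `G/Γ` is second countable. [folklore] -/
instance instSecondCountableQuotient : SecondCountableTopology (Heis ⧸ latticeΓ) :=
  ContinuousConstSMul.secondCountableTopology (Γ := latticeΓ.op) (T := Heis)

/-- `G/Γ` is metrisable (compact Hausdorff second countable; Urysohn). [folklore] -/
instance instMetrizableQuotient : TopologicalSpace.MetrizableSpace (Heis ⧸ latticeΓ) :=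
  inferInstance

/-- A metric on `G/Γ` inducing the quotient topology. [folklore] -/
@[reducible] def quotientMetric : MetricSpace (Heis ⧸ latticeΓ) :=
  TopologicalSpace.metrizableSpaceMetric _

end Heis

/-- **The Heisenberg nilmanifold** `H³(ℝ)/H³(ℤ)` as a `2`-step nilmanifold in the sense of
Def. 8.1 (`Nilmanifold 2`), with a metric inducing the quotient topology.
[cite: GreenTao2010, §8 and App. E, Remark after Lemma E.9] -/
def Nilmanifold.heisenberg : Nilmanifold 2 :=
  letI m : MetricSpace (Heis ⧸ Heis.latticeΓ) := Heis.quotientMetric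
  { E := ℝ × ℝ × ℝ
    G := Heis
    lowerCentralSeries_eq_bot := Heis.lowerCentralSeries_two
    Γ := Heis.latticeΓ
    dist := m.dist
    dist_self := fun a => m.dist_self a
    dist_comm := fun a b => m.dist_comm a b
    dist_triangle := fun a b c => m.dist_triangle a b c
    eq_of_dist_eq_zero := fun a b h => m.eq_of_dist_eq_zero h
    isOpen_iff := fun U => by
      rw [Metric.isOpen_iff]
      refine forall₂_congr fun a _ => ⟨?_, ?_⟩
      · rintro ⟨ε, hε, hball⟩
        exact ⟨ε, hε, fun b hb => hball (Metric.mem_ball'.mpr hb)⟩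
      · rintro ⟨ε, hε, h⟩
        exact ⟨ε, hε, fun b hb => h b (Metric.mem_ball'.mp hb)⟩ }

/-- **Lemma E.9 for the Heisenberg nilmanifold, by hand** ("In this case, Lemma E.9 can easily be
verified by hand"): the lower central series of `H³(ℝ)` is rational with respect to `H³(ℤ)` — the
only level to check is `G_2 = [G, G] = {(0, 0, z)}`, where `{(0, 0, t) : t ∈ [0, 1]}` is a compact
transversal for `Γ ∩ G_2 = {(0, 0, c) : c ∈ ℤ}`. [cite: GreenTao2010, App. E, Remark after Lemma E.9] -/
theorem Nilmanifold.heisenberg_isRational : Nilmanifold.heisenberg.IsRational := by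
  rw [Nilmanifold.isRational_iff]
  intro j h2 hj
  obtain rfl : j = 2 := le_antisymm hj h2
  show HostKra.RationalAt (HostKra.lcs Heis) Heis.latticeΓ 2
  have hl : HostKra.lcs Heis 2 = Heis.centerZ := by
    rw [HostKra.lcs_succ, Subgroup.lowerCentralSeries_succ, Subgroup.lowerCentralSeries_zero,
      Heis.commutator_eq_centerZ]
  refine ⟨(fun t : ℝ => Heis.mk 0 0 t) '' Set.Icc 0 1,
    isCompact_Icc.image (Heis.continuous_mk continuous_const continuous_const continuous_id),
    ?_, ?_⟩
  · rintro _ ⟨t, -, rfl⟩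
    rw [hl]
    exact ⟨rfl, rfl⟩
  · intro g hg
    rw [hl] at hg
    obtain ⟨hx, hy⟩ := Heis.mem_centerZ.mp hg
    refine ⟨Heis.mk 0 0 (g.z - ⌊g.z⌋), ⟨g.z - ⌊g.z⌋,
      ⟨by linarith [Int.floor_le g.z], by linarith [Int.lt_floor_add_one g.z]⟩, rfl⟩, ?_⟩
    refine ⟨⟨0, by simp [hx]⟩, ⟨0, by simp [hy]⟩, ⟨⌊g.z⌋, ?_⟩⟩
    simp only [Heis.z_mul, Heis.z_inv, Heis.x_inv, Heis.x_mk, Heis.y_mk, Heis.z_mk, hy]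
    ring

/-- **Cor. 11.6 for the Heisenberg nilmanifold, unconditionally**: `2`-step nilsequences
`F(gⁿ x)` on `H³(ℝ)/H³(ℤ)` obstruct `U³[N]`-uniformity (`GreenTao2010_nilObstructionAt 2`), by
`GreenTao2010_nilObstructionAt_of_isRational` and the hand verification of Lemma E.9. (Prop. 11.5
for it is likewise unconditional: `Nilmanifold.heisenberg.parallelepipedConstraint
Nilmanifold.heisenberg_isRational`.) [cite: GreenTao2010, Cor. 11.6 and App. E, Remark after Lemma E.9] -/
theorem GreenTao2010_nilObstructionAt_two_heisenberg (M : ℝ) :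
    GreenTao2010_nilObstructionAt 2 Nilmanifold.heisenberg M :=
  GreenTao2010_nilObstructionAt_of_isRational _ Nilmanifold.heisenberg_isRational M

end Literature.NumberTheory.Sieve
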